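import Literature.Algebra.Polynomial.ShefferSequences
import Mathlib.Algebra.Polynomial.Degree.SmallDegree
import Mathlib.Tactic
import HarnessLib

/-!
# Sequences of binomial type and the characterizations of Sheffer sets (Rota–Kahaner–Odlyzko §2 Theorem 1, §5 Propositions 3, 6, §6 Proposition 1)

G.-C. Rota, D. Kahaner, A. Odlyzko, *Finite operator calculus* (1973):

> (§2, pp. 686–687) By a *polynomial sequence* we shall denote a sequence of polynomials `p_i (x)`,
> `i = 0, 1, 2, …`, where `p_i (x)` is exactly of degree `i` for all `i`. A polynomial sequence is
> said to be *of binomial type* if it satisfies the infinite sequence of identities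
> `p_n (x + y) = Σ_{k≥0} C(n,k) p_k (x) p_{n−k} (y)`, `n = 0, 1, 2, …`.
> **Theorem 1.** (a) If `p_n (x)` is a basic sequence for some delta operator `Q`, then it is a
> sequence of polynomials of binomial type. (b) If `p_n (x)` is a sequence of polynomials of
> binomial type, then it is a basic sequence for some delta operator.
> (§5) **Proposition 3.** Let `T` be an invertible shift-invariant operator, let `Q` be a delta
> operator, and let `s_n (x)` be a polynomial sequence. Suppose that [the second expansion]
> holds for all polynomials `f (x)` and all constants `a`. Then the set `s_n (x)` is the Sheffer
> set of the operator `T` relative to the delta operator `Q`.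
> **Proposition 6.** A sequence `s_n (x)` is a Sheffer set relative to a basic set `q_n (x)` if
> and only if `s_n (x + y) = Σ_{k≥0} C(n,k) s_k (x) q_{n−k} (y)`.
> (§6) **Proposition 1.** Let `p_n (x)` be a polynomial sequence with `p_0 (x) = 1`. If `p_n (x)`
> is a Sheffer set then for every delta operator `A` there exists a sequence of constants `s_n` such
> that `A p_n (x) = Σ_{k≥0} C(n,k) p_k (x) s_{n−k}`, `n ≥ 0`. (*) Also, if (*) holds for some delta
> operator `A` and some sequence `s_n`, then `p_n (x)` is a Sheffer set. Note that `A` need not be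
> the delta operator associated with the set `p_n (x)`.

(Robert, *A Course in p-adic Analysis*, Ch. IV §5.2 proves (a) as the "binomial identities" — the
tree's `IsBasicSequence.eval_add_self`; (b) is not in Robert.)

Definitions (with bodies): `IsBinomialType p` (polynomial sequence of binomial type),
`loweringOperator hdeg` (the operator "`Q p_0 = 0`, `Q p_n = n p_{n−1}`" of a polynomial sequence,
RKO's construction in the proofs of Theorem 1 (b) and §6 Proposition 1).

Main statements: `IsBasicSequence.isBinomialType` (Theorem 1 (a)), `IsBinomialType.apply_zero` /
`eval_zero` (`p_0 = 1`, `p_n (0) = 0`), `IsBinomialType.isBasicSequence`,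
`isShiftInvariant_loweringOperator`, `isDeltaOperator_loweringOperator`,
`IsBinomialType.exists_isDeltaOperator` (Theorem 1 (b)), `isBinomialType_iff`,
`IsDeltaOperator.eq_of_isBasicSequence` (the delta operator of a basic sequence is unique),
`IsBasicSequence.map_eq_of_taylor_map_eq_sum` / `isShefferSequence_of_taylor_map_eq_sum`
(Proposition 3), `isShefferSequence_iff_eval_add` (Proposition 6),
`IsShefferSequence.exists_map_eq_sum_choose` / `isDeltaOperator_loweringOperator_of_map_eq_sum_choose` /
`exists_isShefferSequence_of_map_eq_sum_choose` (§6 Proposition 1).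

## References
* [RotaKahanerOdlyzko1973] G.-C. Rota, D. Kahaner, A. Odlyzko, *On the foundations of
  combinatorial theory VIII. Finite operator calculus*, J. Math. Anal. Appl. 42 (1973) 684–760,
  §2 pp. 686–690 (Theorem 1), §5 Proposition 3 (pp. 701–702), Proposition 6 (p. 703),
  §6 Proposition 1 (pp. 703–705).
* [Robert2000PadicAnalysis] A. M. Robert, *A Course in p-adic Analysis*, GTM 198, Springer (2000),
  Ch. IV §5.2 (Binomial identities), p. 197.
-/

noncomputable section

open Polynomial Finset

namespace Literature.Algebra.Polynomial

variable {K : Type*} [Field K]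

section Definitions

/-- A **polynomial sequence of binomial type** (Rota–Kahaner–Odlyzko §2): `p_n` is exactly of
degree `n` and `p_n (x + y) = Σ_{k=0}^{n} C(n,k) p_k (x) p_{n−k} (y)` for all `n`, `x`, `y`.
[cite: RotaKahanerOdlyzko1973, §2, pp. 686–687] -/
structure IsBinomialType (p : ℕ → K[X]) : Prop where
  degree_eq : ∀ n : ℕ, (p n).degree = n
  eval_add : ∀ (n : ℕ) (x y : K), (p n).eval (x + y) =
    ∑ k ∈ range (n + 1), (n.choose k : K) * (p k).eval x * (p (n - k)).eval y

/-- The `K`-basis `(p_n)` of `K[X]` given by a polynomial sequence (`deg p_n = n` exactly).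
[cite: RotaKahanerOdlyzko1973, §2 ("every polynomial is a linear combination of the `p_n`"), p. 689] -/
def seqBasis {p : ℕ → K[X]} (hdeg : ∀ n : ℕ, (p n).degree = n) : Module.Basis ℕ K K[X] :=
  (⟨p, hdeg⟩ : Polynomial.Sequence K).basis fun n =>
    isUnit_iff_ne_zero.2 (leadingCoeff_ne_zero.2 (Polynomial.Sequence.ne_zero ⟨p, hdeg⟩ n))

/-- **The operator `Q` defined by `Q p_0 = 0`, `Q p_n = n p_{n−1}`** ("and extending by linearity")
attached to a polynomial sequence `(p_n)` — Rota–Kahaner–Odlyzko's construction of the delta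
operator of a sequence of binomial type (proof of Theorem 1 (b)) and of a Sheffer set (proof of §6
Proposition 1). [cite: RotaKahanerOdlyzko1973, §2 (proof of Theorem 1 (b)), p. 690]
[cite: RotaKahanerOdlyzko1973, §6 (proof of Proposition 1), p. 704] -/
def loweringOperator {p : ℕ → K[X]} (hdeg : ∀ n : ℕ, (p n).degree = n) : K[X] →ₗ[K] K[X] :=
  (seqBasis hdeg).constr K fun n => (n : K) • p (n - 1)

end Definitions

/-! ## Polynomial sequences: the basis and the lowering operator -/

section Lowering

variable {p : ℕ → K[X]} (hdeg : ∀ n : ℕ, (p n).degree = n)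
include hdeg

/-- `seqBasis n = p_n`. [cite: RotaKahanerOdlyzko1973, §2, p. 689] -/
theorem seqBasis_apply (n : ℕ) : seqBasis hdeg n = p n :=
  Polynomial.Sequence.basis_eq_self _ _ n

/-- Two linear maps agreeing on a polynomial sequence are equal ("by the familiar linearity
argument"). [cite: RotaKahanerOdlyzko1973, §2 (proof of Theorem 1), p. 690] -/
theorem linearMap_ext_of_degree_eq {M : Type*} [AddCommGroup M] [Module K M] {S T : K[X] →ₗ[K] M}
    (h : ∀ n, S (p n) = T (p n)) : S = T :=
  (seqBasis hdeg).ext fun n => by rw [seqBasis_apply]; exact h n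

/-- `Q p_n = n p_{n−1}`. [cite: RotaKahanerOdlyzko1973, §2 (proof of Theorem 1 (b)), p. 690] -/
theorem loweringOperator_apply (n : ℕ) : loweringOperator hdeg (p n) = (n : K) • p (n - 1) := by
  have h := (seqBasis hdeg).constr_basis K (fun n => (n : K) • p (n - 1)) n
  rwa [seqBasis_apply] at h

/-- `Q p_0 = 0`. [cite: RotaKahanerOdlyzko1973, §2 (proof of Theorem 1 (b)), p. 690] -/
theorem loweringOperator_apply_zero : loweringOperator hdeg (p 0) = 0 := by
  rw [loweringOperator_apply, Nat.cast_zero, zero_smul]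

/-- `Q p_{n+1} = (n+1) p_n`. [cite: RotaKahanerOdlyzko1973, §2 (proof of Theorem 1 (b)), p. 690] -/
theorem loweringOperator_apply_succ (n : ℕ) :
    loweringOperator hdeg (p (n + 1)) = ((n + 1 : ℕ) : K) • p n := by
  rw [loweringOperator_apply, Nat.add_sub_cancel]

/-- `(p_n)` satisfies the two algebraic clauses of a Sheffer set for its lowering operator.
[cite: RotaKahanerOdlyzko1973, §6 (proof of Proposition 1: "`p_n (x)` is a Sheffer set associated
with the delta operator `Q`"), p. 704] -/
theorem isShefferSequence_loweringOperator : IsShefferSequence (loweringOperator hdeg) p :=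
  ⟨hdeg, loweringOperator_apply_succ hdeg⟩

/-- **"Clearly `Qx` must be a nonzero constant"**: `Q X = c ≠ 0` constant, since `p_1 = aX + b`
with `a ≠ 0`, `Q p_1 = p_0` is a nonzero constant and `Q p_0 = 0`.
[cite: RotaKahanerOdlyzko1973, §2 (proof of Theorem 1 (b)), p. 690] -/
theorem exists_loweringOperator_X : ∃ c : K, c ≠ 0 ∧ loweringOperator hdeg X = C c := by
  have h0 : (p 0).natDegree = 0 := natDegree_eq_of_degree_eq_some (hdeg 0)
  have h1 : (p 1).natDegree = 1 := natDegree_eq_of_degree_eq_some (hdeg 1)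
  set c0 : K := (p 0).coeff 0 with hc0def
  have hp0 : p 0 = C c0 := eq_C_of_natDegree_eq_zero h0
  have hc0 : c0 ≠ 0 := by
    intro h
    have := hdeg 0
    rw [hp0, h, C_0, degree_zero] at this
    exact WithBot.bot_ne_coe this
  set a : K := (p 1).coeff 1 with ha
  set b : K := (p 1).coeff 0 with hb
  have ha0 : a ≠ 0 := by
    have h := leadingCoeff_ne_zero.2 (Polynomial.Sequence.ne_zero ⟨p, hdeg⟩ 1)
    rwa [leadingCoeff, h1] at h
  have hp1 : p 1 = C a * X + C b := eq_X_add_C_of_natDegree_le_one h1.le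
  have hX : (X : K[X]) = a⁻¹ • (p 1 - (b / c0) • p 0) := by
    rw [hp1, hp0, smul_eq_C_mul, smul_eq_C_mul, ← map_mul, div_mul_cancel₀ _ hc0, add_sub_cancel_right,
      ← mul_assoc, ← map_mul, inv_mul_cancel₀ ha0, C_1, one_mul]
  refine ⟨a⁻¹ * c0, mul_ne_zero (inv_ne_zero ha0) hc0, ?_⟩
  rw [hX, map_smul, map_sub, map_smul, loweringOperator_apply_zero hdeg, smul_zero, sub_zero,
    loweringOperator_apply hdeg 1, Nat.cast_one, one_smul, Nat.sub_self, hp0, smul_eq_C_mul, ← map_mul]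

/-- The lowering operator is a delta operator as soon as it is shift-invariant.
[cite: RotaKahanerOdlyzko1973, §2 (proof of Theorem 1 (b): "all that remains to be shown is that `Q`
is shift-invariant"), p. 690] -/
theorem isDeltaOperator_loweringOperator_of_isShiftInvariant
    (h : IsShiftInvariant (loweringOperator hdeg)) : IsDeltaOperator (loweringOperator hdeg) :=
  ⟨h, exists_loweringOperator_X hdeg⟩

end Lowering

/-! ## Sequences of binomial type: Theorem 1 -/

namespace IsBinomialType

variable {p : ℕ → K[X]}

/-- `deg p_n = n` as a `natDegree`. [cite: RotaKahanerOdlyzko1973, §2, p. 686] -/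
theorem natDegree_eq (hp : IsBinomialType p) (n : ℕ) : (p n).natDegree = n :=
  natDegree_eq_of_degree_eq_some (hp.degree_eq n)

/-- `p_n ≠ 0`. [cite: RotaKahanerOdlyzko1973, §2, p. 686] -/
theorem ne_zero (hp : IsBinomialType p) (n : ℕ) : p n ≠ 0 :=
  Polynomial.Sequence.ne_zero ⟨p, hp.degree_eq⟩ n

/-- **`p_0 = 1`** ("since each `p_i (x)` is exactly of degree `i`, it follows that `p_0 (0) = 1` (and,
hence, `p_0 (x) = 1`)"). [cite: RotaKahanerOdlyzko1973, §2 (proof of Theorem 1 (b)), p. 690] -/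
theorem apply_zero (hp : IsBinomialType p) : p 0 = 1 := by
  have h0 : p 0 = C ((p 0).coeff 0) := eq_C_of_natDegree_eq_zero (hp.natDegree_eq 0)
  have hc : (p 0).coeff 0 ≠ 0 := fun h => hp.ne_zero 0 (by rw [h0, h, C_0])
  have h := hp.eval_add 0 0 0
  rw [zero_add, sum_range_one, Nat.choose_self, Nat.cast_one, one_mul, Nat.sub_zero, h0, eval_C] at h
  -- `c = c * c` with `c ≠ 0`
  have hc1 : (p 0).coeff 0 = 1 := mul_left_cancel₀ hc (by rw [mul_one]; exact h.symm)
  rw [h0, hc1, C_1]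

/-- **`p_n (0) = 0` for `n ≥ 1`** ("and `p_i (0) = 0` for all other `i`").
[cite: RotaKahanerOdlyzko1973, §2 (proof of Theorem 1 (b)), p. 690] -/
theorem eval_zero (hp : IsBinomialType p) {n : ℕ} (hn : n ≠ 0) : (p n).eval 0 = 0 := by
  induction n using Nat.strong_induction_on with
  | _ n ih =>
    obtain ⟨m, rfl⟩ := Nat.exists_eq_succ_of_ne_zero hn
    have h := hp.eval_add (m + 1) 0 0
    rw [zero_add, sum_range_succ, sum_range_succ', Nat.choose_self, Nat.choose_zero_right, Nat.cast_one,
      one_mul, one_mul, Nat.sub_self, Nat.sub_zero, hp.apply_zero, eval_one, one_mul, mul_one] at h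
    have hmid : ∑ k ∈ range m, (((m + 1).choose (k + 1) : ℕ) : K) * (p (k + 1)).eval 0 *
        (p (m + 1 - (k + 1))).eval 0 = 0 := by
      refine sum_eq_zero fun k hk => ?_
      have hk' := mem_range.1 hk
      rw [ih (m + 1 - (k + 1)) (by omega) (by omega), mul_zero]
    rw [hmid, zero_add] at h
    -- `a = a + a`
    linear_combination -h

/-- **A sequence of binomial type is a basic sequence of its lowering operator** (properties (1)–(3)
of basic sequences; the delta-operator property of `Q` is `isDeltaOperator_loweringOperator`).
[cite: RotaKahanerOdlyzko1973, §2 (proof of Theorem 1 (b)), p. 690] -/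
theorem isBasicSequence (hp : IsBinomialType p) : IsBasicSequence (loweringOperator hp.degree_eq) p where
  natDegree_eq := hp.natDegree_eq
  map_succ := loweringOperator_apply_succ hp.degree_eq
  apply_zero := hp.apply_zero
  eval_zero_succ n := hp.eval_zero (Nat.succ_ne_zero n)

/-- The binomial identity as an identity of polynomials: `p_n (X + y) = Σ_k C(n,k) p_{n−k} (y) · p_k`.
[cite: RotaKahanerOdlyzko1973, §2 (proof of Theorem 1 (b): "we may trivially write the property of
being of binomial type in the form `p_n (x + y) = Σ_k p_k (y)/k! · Q^k p_n (x)`"), p. 690] -/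
theorem taylor_apply [CharZero K] (hp : IsBinomialType p) (y : K) (n : ℕ) :
    taylor y (p n) = ∑ k ∈ range (n + 1), ((n.choose k : K) * (p (n - k)).eval y) • p k := by
  apply Polynomial.funext
  intro x
  rw [taylor_eval, hp.eval_add n x y, eval_finsetSum]
  exact sum_congr rfl fun k _ => by rw [eval_smul, smul_eq_mul]; ring

/-- **"All that remains to be shown is that `Q` is shift-invariant"**: the lowering operator of a
sequence of binomial type commutes with translations (checked on the basis `(p_n)` via
`C(n,k+1) (k+1) = n C(n−1,k)`). [cite: RotaKahanerOdlyzko1973, §2 (proof of Theorem 1 (b)), p. 690] -/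
theorem isShiftInvariant_loweringOperator [CharZero K] (hp : IsBinomialType p) :
    IsShiftInvariant (loweringOperator hp.degree_eq) := by
  intro y f
  suffices h : loweringOperator hp.degree_eq ∘ₗ (taylor y : K[X] →ₗ[K] K[X]) =
      (taylor y : K[X] →ₗ[K] K[X]) ∘ₗ loweringOperator hp.degree_eq from LinearMap.congr_fun h f
  refine linearMap_ext_of_degree_eq hp.degree_eq fun n => ?_
  rw [LinearMap.comp_apply, LinearMap.comp_apply]
  cases n with
  | zero =>
    rw [loweringOperator_apply_zero, map_zero, hp.apply_zero, taylor_one, C_1, ← hp.apply_zero,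
      loweringOperator_apply_zero]
  | succ m =>
    have hL : loweringOperator hp.degree_eq (taylor y (p (m + 1))) =
        ∑ k ∈ range (m + 1), ((((m + 1).choose (k + 1) : ℕ) : K) * (p (m + 1 - (k + 1))).eval y *
          ((k + 1 : ℕ) : K)) • p k := by
      rw [hp.taylor_apply y (m + 1), map_sum, sum_range_succ', map_smul, loweringOperator_apply_zero,
        smul_zero, add_zero]
      refine sum_congr rfl fun k _ => ?_
      rw [map_smul, loweringOperator_apply_succ, smul_smul]
    have hR : taylor y (loweringOperator hp.degree_eq (p (m + 1))) =
        ∑ k ∈ range (m + 1), (((m + 1 : ℕ) : K) * ((m.choose k : K) * (p (m - k)).eval y)) • p k := by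
      rw [loweringOperator_apply_succ, map_smul, hp.taylor_apply y m, smul_sum]
      exact sum_congr rfl fun k _ => by rw [smul_smul]
    rw [hL, hR]
    refine sum_congr rfl fun k _ => ?_
    rw [Nat.add_sub_add_right]
    congr 1
    have h' : ((m + 1 : ℕ) : K) * (m.choose k : K) = ((m + 1).choose (k + 1) : K) * ((k + 1 : ℕ) : K) := by
      exact_mod_cast Nat.add_one_mul_choose_eq m k
    linear_combination (p (m - k)).eval y * h'.symm

/-- **The lowering operator of a sequence of binomial type is a delta operator.**
[cite: RotaKahanerOdlyzko1973, §2 (proof of Theorem 1 (b)), p. 690] -/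
theorem isDeltaOperator_loweringOperator [CharZero K] (hp : IsBinomialType p) :
    IsDeltaOperator (loweringOperator hp.degree_eq) :=
  isDeltaOperator_loweringOperator_of_isShiftInvariant hp.degree_eq hp.isShiftInvariant_loweringOperator

/-- **Rota–Kahaner–Odlyzko Theorem 1 (b)**: a sequence of polynomials of binomial type is the basic
sequence of some delta operator. [cite: RotaKahanerOdlyzko1973, §2 Theorem 1 (b), p. 689] -/
theorem exists_isDeltaOperator [CharZero K] (hp : IsBinomialType p) :
    ∃ δ : K[X] →ₗ[K] K[X], IsDeltaOperator δ ∧ IsBasicSequence δ p :=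
  ⟨loweringOperator hp.degree_eq, hp.isDeltaOperator_loweringOperator, hp.isBasicSequence⟩

end IsBinomialType

/-- **The delta operator of a basic sequence is unique**: two delta operators with a common basic
sequence coincide (they agree on the basis `(p_n)`).
[cite: RotaKahanerOdlyzko1973, §2 (proof of Theorem 1 (b): `Q` is "defined by" `Q p_n = n p_{n−1}`),
p. 690] -/
theorem IsDeltaOperator.eq_of_isBasicSequence {δ δ' : K[X] →ₗ[K] K[X]} {p : ℕ → K[X]}
    (hδ : IsDeltaOperator δ) (hδ' : IsDeltaOperator δ') (hp : IsBasicSequence δ p)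
    (hp' : IsBasicSequence δ' p) : δ = δ' :=
  linearMap_ext_of_degree_eq hp.degree_eq fun n => by
    cases n with
    | zero => rw [hp.apply_zero, hδ.map_one, hδ'.map_one]
    | succ n => rw [hp.map_succ, hp'.map_succ]

/-- A delta operator with basic sequence `(p_n)` IS the lowering operator of `(p_n)`.
[cite: RotaKahanerOdlyzko1973, §2 (proof of Theorem 1 (b)), p. 690] -/
theorem IsDeltaOperator.eq_loweringOperator {δ : K[X] →ₗ[K] K[X]} {p : ℕ → K[X]}
    (hδ : IsDeltaOperator δ) (hp : IsBasicSequence δ p) : δ = loweringOperator hp.degree_eq :=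
  linearMap_ext_of_degree_eq hp.degree_eq fun n => by
    cases n with
    | zero => rw [hp.apply_zero, hδ.map_one, ← hp.apply_zero, loweringOperator_apply_zero]
    | succ n => rw [hp.map_succ, loweringOperator_apply_succ]

section CharZero

variable [CharZero K]

/-- **Rota–Kahaner–Odlyzko Theorem 1 (a)**: a basic sequence of a delta operator is of binomial type
(the tree's binomial identities `IsBasicSequence.eval_add_self`, Robert §5.2).
[cite: RotaKahanerOdlyzko1973, §2 Theorem 1 (a), p. 689]
[cite: Robert2000PadicAnalysis, Ch. IV §5.2 (Binomial identities), p. 197] -/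
theorem IsBasicSequence.isBinomialType {δ : K[X] →ₗ[K] K[X]} {p : ℕ → K[X]} (hδ : IsDeltaOperator δ)
    (hp : IsBasicSequence δ p) : IsBinomialType p :=
  ⟨hp.degree_eq, hp.eval_add_self hδ⟩

/-- THE basic sequence of a delta operator is of binomial type.
[cite: RotaKahanerOdlyzko1973, §2 Theorem 1 (a), p. 689] -/
theorem IsDeltaOperator.isBinomialType_basicSequence {δ : K[X] →ₗ[K] K[X]} (hδ : IsDeltaOperator δ) :
    IsBinomialType hδ.basicSequence :=
  hδ.isBasicSequence_basicSequence.isBinomialType hδ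

/-- **Theorem 1, both halves**: `(p_n)` is of binomial type iff it is the basic sequence of a delta
operator. [cite: RotaKahanerOdlyzko1973, §2 Theorem 1, p. 689] -/
theorem isBinomialType_iff {p : ℕ → K[X]} :
    IsBinomialType p ↔ ∃ δ : K[X] →ₗ[K] K[X], IsDeltaOperator δ ∧ IsBasicSequence δ p :=
  ⟨fun hp => hp.exists_isDeltaOperator, fun ⟨_, hδ, hp⟩ => hp.isBinomialType hδ⟩

/-- "The simplest sequence of binomial type is of course `xⁿ`."
[cite: RotaKahanerOdlyzko1973, §2, p. 687] -/
theorem isBinomialType_X_pow : IsBinomialType (K := K) fun n => X ^ n :=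
  isBasicSequence_derivative_X_pow.isBinomialType isDeltaOperator_derivative

/-- The lowering operator of `(xⁿ)` is `D`. [cite: RotaKahanerOdlyzko1973, §2 ("`xⁿ`, basic for the
derivative operator `D`"), p. 689] -/
theorem loweringOperator_X_pow :
    loweringOperator (isBinomialType_X_pow (K := K)).degree_eq = derivative :=
  (isDeltaOperator_derivative.eq_loweringOperator isBasicSequence_derivative_X_pow).symm

/-! ## §5 Proposition 3: the converse of the Second Expansion Theorem -/

/-- **Proposition 3 (converse of the Second Expansion Theorem)**, in the tree's normalization
`S p_n = s_n` of `IsShefferSequence.taylor_map_eq_sum`: if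
`τ_y (S f) = Σ_{k<N} (δ^k f)(y)/k! · s_k` for all `f` (`N > deg f`) and all `y`, then `S p_n = s_n`
("setting `f (x) = p_n (x)` … and setting `x = 0`, this yields `p_n = T s_n`").
[cite: RotaKahanerOdlyzko1973, §5 Proposition 3, pp. 701–702] -/
theorem IsBasicSequence.map_eq_of_taylor_map_eq_sum {δ : K[X] →ₗ[K] K[X]} {p : ℕ → K[X]}
    (hp : IsBasicSequence δ p) {S : K[X] →ₗ[K] K[X]} {s : ℕ → K[X]}
    (h : ∀ (f : K[X]) (y : K) (N : ℕ), f.natDegree < N →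
      taylor y (S f) = ∑ k ∈ range N, (((δ ^ k) f).eval y / (k.factorial : K)) • s k) (n : ℕ) :
    S (p n) = s n := by
  have h1 := h (p n) 0 (n + 1) (by rw [hp.natDegree_eq]; exact lt_add_one n)
  rw [taylor_zero, sum_eq_single n] at h1
  · rw [h1, hp.pow_self_apply, eval_C, div_self (Nat.cast_ne_zero.2 (Nat.factorial_ne_zero n)),
      one_smul]
  · intro k hk hkn
    have hk' : k < n := lt_of_le_of_ne (Nat.lt_succ_iff.1 (mem_range.1 hk)) hkn
    rw [hp.pow_apply_of_le hk'.le, eval_smul, hp.eval_zero (Nat.sub_ne_zero_of_lt hk'), smul_zero,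
      zero_div, zero_smul]
  · intro hn
    exact absurd (self_mem_range_succ n) hn

/-- **Proposition 3, conclusion as printed**: under the same hypothesis with `S` an invertible
composition operator, `(s_n)` is the Sheffer set of `S` relative to `δ` (`s_n = S p_n`).
[cite: RotaKahanerOdlyzko1973, §5 Proposition 3, pp. 701–702] -/
theorem isShefferSequence_of_taylor_map_eq_sum {δ : K[X] →ₗ[K] K[X]} {p : ℕ → K[X]}
    (hδ : IsDeltaOperator δ) (hp : IsBasicSequence δ p) {S : K[X] →ₗ[K] K[X]} (hS : IsShiftInvariant S)
    (hS1 : S 1 ≠ 0) {s : ℕ → K[X]}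
    (h : ∀ (f : K[X]) (y : K) (N : ℕ), f.natDegree < N →
      taylor y (S f) = ∑ k ∈ range N, (((δ ^ k) f).eval y / (k.factorial : K)) • s k) :
    IsShefferSequence δ s ∧ ∀ n, S (p n) = s n := by
  have hs : (fun n => S (p n)) = s := funext (hp.map_eq_of_taylor_map_eq_sum h)
  exact ⟨hs ▸ hp.isShefferSequence_map hδ hS hS1, hp.map_eq_of_taylor_map_eq_sum h⟩

/-! ## §5 Proposition 6: Sheffer sets are characterized by the binomial identity (S) -/

/-- A sequence satisfying (S) at `y = 0` is `s_n = Σ_k C(n,k) s_{n−k} (0) · p_k`.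
[cite: RotaKahanerOdlyzko1973, §5 Proposition 2 Corollary 1, p. 701] -/
theorem eq_sum_of_eval_add {p s : ℕ → K[X]}
    (h : ∀ (n : ℕ) (x y : K), (s n).eval (x + y) =
      ∑ k ∈ range (n + 1), (n.choose k : K) * (p k).eval x * (s (n - k)).eval y) (n : ℕ) :
    s n = ∑ k ∈ range (n + 1), ((n.choose k : K) * (s (n - k)).eval 0) • p k := by
  apply Polynomial.funext
  intro x
  rw [← add_zero x, h n x 0, add_zero, eval_finsetSum]
  exact sum_congr rfl fun k _ => by rw [eval_smul, smul_eq_mul]; ring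

omit [CharZero K] in
/-- If `s_n = Σ_k C(n,k) c_{n−k} · p_k` for a basic sequence `(p_k)` of `δ`, then `δ s_{n+1} =
(n+1) s_n` (the computation `C(n+1,k+1) (k+1) = (n+1) C(n,k)`).
[cite: RotaKahanerOdlyzko1973, §5 Proposition 6, p. 703] -/
theorem map_succ_of_eq_sum_choose {δ : K[X] →ₗ[K] K[X]} {p s : ℕ → K[X]} (hδ : IsDeltaOperator δ)
    (hp : IsBasicSequence δ p) (c : ℕ → K)
    (h : ∀ n, s n = ∑ k ∈ range (n + 1), ((n.choose k : K) * c (n - k)) • p k) (n : ℕ) :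
    δ (s (n + 1)) = ((n + 1 : ℕ) : K) • s n := by
  rw [h (n + 1), map_sum, sum_range_succ', map_smul, hp.apply_zero, hδ.map_one, smul_zero, add_zero,
    h n, smul_sum]
  refine sum_congr rfl fun k hk => ?_
  have hkn : k ≤ n := Nat.lt_succ_iff.1 (mem_range.1 hk)
  rw [map_smul, hp.map_succ, smul_smul, smul_smul, show n + 1 - (k + 1) = n - k by omega]
  congr 1
  have h' : ((n + 1 : ℕ) : K) * (n.choose k : K) = ((n + 1).choose (k + 1) : K) * ((k + 1 : ℕ) : K) := by
    have h0 := congrArg (Nat.cast (R := K)) (Nat.add_one_mul_choose_eq n k)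
    push_cast at h0 ⊢
    linear_combination h0
  linear_combination c (n - k) * h'.symm

/-- **Rota–Kahaner–Odlyzko §5 Proposition 6**: `(s_n)` is a Sheffer set relative to the basic set
`(p_n)` of `δ` iff `deg s_n = n` and `s_n (x + y) = Σ_k C(n,k) p_k (x) s_{n−k} (y)` (the identity (S)
of Robert §6.1). [cite: RotaKahanerOdlyzko1973, §5 Proposition 6, p. 703]
[cite: Robert2000PadicAnalysis, Ch. IV §6.1 (S), p. 208] -/
theorem isShefferSequence_iff_eval_add {δ : K[X] →ₗ[K] K[X]} {p : ℕ → K[X]} (hδ : IsDeltaOperator δ)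
    (hp : IsBasicSequence δ p) {s : ℕ → K[X]} :
    IsShefferSequence δ s ↔ (∀ n : ℕ, (s n).degree = n) ∧ ∀ (n : ℕ) (x y : K), (s n).eval (x + y) =
      ∑ k ∈ range (n + 1), (n.choose k : K) * (p k).eval x * (s (n - k)).eval y := by
  refine ⟨fun hs => ⟨hs.degree_eq, hs.eval_add hδ hp⟩, fun ⟨hdeg, h⟩ => ⟨hdeg, ?_⟩⟩
  exact map_succ_of_eq_sum_choose hδ hp (fun j => (s j).eval 0) (eq_sum_of_eval_add h)

/-! ## §6 Proposition 1: recurrence formulas -/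

/-- **§6 Proposition 1, first half**: if `(p_n)` is a Sheffer set (for `δ`), then for EVERY delta
operator `A` there are constants `s_k` with `s_0 = 0` such that
`A p_n = Σ_{k=0}^{n} C(n,k) p_k s_{n−k}` — namely `s_k = (A q_k)(0)`, `(q_k)` the basic set of `δ`
("note that `A` need not be the delta operator associated with the set `p_n (x)`").
[cite: RotaKahanerOdlyzko1973, §6 Proposition 1, pp. 703–705] -/
theorem IsShefferSequence.exists_map_eq_sum_choose {δ : K[X] →ₗ[K] K[X]} {s : ℕ → K[X]}
    (hδ : IsDeltaOperator δ) (hs : IsShefferSequence δ s) {A : K[X] →ₗ[K] K[X]} (hA : IsDeltaOperator A) :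
    ∃ c : ℕ → K, c 0 = 0 ∧
      ∀ n, A (s n) = ∑ k ∈ range (n + 1), ((n.choose k : K) * c (n - k)) • s k := by
  set p := hδ.basicSequence with hpdef
  have hp : IsBasicSequence δ p := hδ.isBasicSequence_basicSequence
  obtain ⟨S, hS, -, hSp⟩ := hs.exists_isShiftInvariant hδ hp
  refine ⟨fun k => (A (p k)).eval 0, ?_, fun n => ?_⟩
  · show (A (p 0)).eval 0 = 0
    rw [hp.apply_zero, hA.map_one, Polynomial.eval_zero]
  rw [← hSp n, hA.isShiftInvariant.comm_apply hS,
    hA.isShiftInvariant.eq_sum_pow_apply hδ hp (p n) (N := n + 1)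
      (by rw [hp.natDegree_eq]; exact lt_add_one n), map_sum]
  conv_rhs => rw [← sum_range_reflect]
  refine sum_congr rfl fun k hk => ?_
  have hkn : k ≤ n := Nat.lt_succ_iff.1 (mem_range.1 hk)
  rw [map_smul, hp.pow_apply_of_le hkn, map_smul, hSp, smul_smul, Nat.add_sub_cancel,
    Nat.sub_sub_self hkn, Nat.choose_symm hkn, Nat.descFactorial_eq_factorial_mul_choose, Nat.cast_mul]
  congr 1
  have hk0 : (k.factorial : K) ≠ 0 := Nat.cast_ne_zero.2 (Nat.factorial_ne_zero k)
  field_simp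

/-- **§6 Proposition 1, second half**: if a polynomial sequence `(p_n)` (exact degrees) with
`p_0 = 1` satisfies `A p_n = Σ_{k=0}^{n} C(n,k) p_k s_{n−k}` for SOME delta operator `A` and some
constants `s_k`, then `(p_n)` is a Sheffer set: its lowering operator `Q` (`Q p_n = n p_{n−1}`)
commutes with `A`, hence is shift-invariant, hence a delta operator.
[cite: RotaKahanerOdlyzko1973, §6 Proposition 1 (proof), pp. 703–704] -/
theorem isDeltaOperator_loweringOperator_of_map_eq_sum_choose {p : ℕ → K[X]}
    (hdeg : ∀ n : ℕ, (p n).degree = n) {A : K[X] →ₗ[K] K[X]} (hA : IsDeltaOperator A) (c : ℕ → K)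
    (h : ∀ n, A (p n) = ∑ k ∈ range (n + 1), ((n.choose k : K) * c (n - k)) • p k) :
    IsDeltaOperator (loweringOperator hdeg) ∧ IsShefferSequence (loweringOperator hdeg) p := by
  -- `A Q = Q A` on the basis `(p_n)`
  have hcomm : loweringOperator hdeg ∘ₗ A = A ∘ₗ loweringOperator hdeg := by
    refine linearMap_ext_of_degree_eq hdeg fun n => ?_
    rw [LinearMap.comp_apply, LinearMap.comp_apply]
    cases n with
    | zero =>
      rw [loweringOperator_apply_zero, map_zero, h 0, zero_add, sum_range_one, map_smul,
        loweringOperator_apply_zero, smul_zero]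
    | succ m =>
      have hL : loweringOperator hdeg (A (p (m + 1))) =
          ∑ k ∈ range (m + 1), ((((m + 1).choose (k + 1) : ℕ) : K) * c (m + 1 - (k + 1)) *
            ((k + 1 : ℕ) : K)) • p k := by
        rw [h (m + 1), map_sum, sum_range_succ', map_smul, loweringOperator_apply_zero, smul_zero,
          add_zero]
        refine sum_congr rfl fun k _ => ?_
        rw [map_smul, loweringOperator_apply_succ, smul_smul]
      have hR : A (loweringOperator hdeg (p (m + 1))) =
          ∑ k ∈ range (m + 1), (((m + 1 : ℕ) : K) * ((m.choose k : K) * c (m - k))) • p k := by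
        rw [loweringOperator_apply_succ, map_smul, h m, smul_sum]
        exact sum_congr rfl fun k _ => by rw [smul_smul]
      rw [hL, hR]
      refine sum_congr rfl fun k _ => ?_
      rw [Nat.add_sub_add_right]
      congr 1
      have h' : ((m + 1 : ℕ) : K) * (m.choose k : K) = ((m + 1).choose (k + 1) : K) * ((k + 1 : ℕ) : K) := by
        exact_mod_cast Nat.add_one_mul_choose_eq m k
      linear_combination c (m - k) * h'.symm
  exact ⟨isDeltaOperator_loweringOperator_of_isShiftInvariant hdeg
      (isShiftInvariant_of_comm_of_isDeltaOperator hA hcomm), isShefferSequence_loweringOperator hdeg⟩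

/-- **§6 Proposition 1, second half, as printed**: "if (*) holds for some delta operator `A` and
some sequence `s_n`, then `p_n (x)` is a Sheffer set" (RKO also assume `p_0 = 1`; the proof does
not use it). [cite: RotaKahanerOdlyzko1973, §6 Proposition 1, pp. 703–704] -/
theorem exists_isShefferSequence_of_map_eq_sum_choose {p : ℕ → K[X]} (hdeg : ∀ n : ℕ, (p n).degree = n)
    {A : K[X] →ₗ[K] K[X]} (hA : IsDeltaOperator A) (c : ℕ → K)
    (h : ∀ n, A (p n) = ∑ k ∈ range (n + 1), ((n.choose k : K) * c (n - k)) • p k) :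
    ∃ δ : K[X] →ₗ[K] K[X], IsDeltaOperator δ ∧ IsShefferSequence δ p :=
  ⟨loweringOperator hdeg, isDeltaOperator_loweringOperator_of_map_eq_sum_choose hdeg hA c h⟩

end CharZero

end Literature.Algebra.Polynomial
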